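import Summits.BirchSwinnertonDyer.BirchSwinnertonDyer.Theorems.SignedLowerHalvesSmallImageLowerHalfBothSignsRttOneSidedCruxExistsPartner
import HarnessLib

/-!
# Route `SignedLowerHalves`, crux L `SmallImageLowerHalfBothSigns` (item stmt-BirchSwinnertonDyer-23599), line `rtt_w3` —
# file «P6a» of the LEAD's PORT (cruxlead-23599 g16, WORD 2026-08-31T20:17:45Z): the PER-PAIR and `p = 3` variants of
# `smallImageLowerHalfBothSigns_of_oneSignFloor_of_existsPartnerPSB` (p754919, `…RttOneSidedCruxExistsPartner`)

Width seat `bsd-line-slh-p3-w3` g33; helper `--supports stmt-BirchSwinnertonDyer-23599`; THEOREMS ONLY — no definition, no named fact,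
no `sorry`; CONDITIONAL re-packagings of an existing sorry-free composition; closes nothing; BSD is not proved by any of this.

WHY. In the proof of `smallImageLowerHalfBothSigns_of_oneSignFloor_of_existsPartnerPSB` the class-wide analytic one-sign floor `hfloor5`
(= the line's stub `stub_muOneSign_ns_ge5`; conjecture-grade: Perrin-Riou 2003 Conj. 6.1.1 / Pollack 2003 Conj. 6.3, one sign) is consumed
ONLY at the pair `(W, p)` under discussion and ONLY on the branch `5 ≤ p`; the branch `p = 3` runs on THEOREM B
(`forall_kobayashiLowerDivisibility_three_of_lamTransport_le`) and touches no floor. This file records exactly that, as three theorems whose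
hypotheses are those of p754919 VERBATIM (the twelve prints `hJ h12 h41 h5 h3 hD hC hS hmod hKim hPR hV`, Kan₂ `hKan` = landed p747435, and
the ∃-partner-PSB binder `hEX3`), minus `hfloor5`:

* §1 `forall_kobayashiLowerDivisibility_three_of_existsPartnerPSB` — at `p = 3`, on the small-image X7 class (`a_3 = 0`, `¬ Surj`, non-CM):
  `KobayashiLowerDivisibility W 3 ε` for BOTH signs, from the prints ∧ Kan₂ ∧ ∃-partner-PSB and NOTHING ELSE (no μ-hypothesis);
* §2 `kobayashiMainConjecture_of_oneSignFloorAt_of_existsPartnerPSB` — at ONE pair `(W, p)`, `p` odd: a unit-content certificate for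
  Kobayashi's `L_p^{ε₀}` AT THAT PAIR gives the full signed main conjecture `KobayashiMainConjecture W p ε₀` for that sign;
* §3 `forall_kobayashiLowerDivisibility_of_oneSignFloorAt_of_existsPartnerPSB` — at ONE pair, `p` odd: the one-sign floor AT THAT PAIR
  (`∃ ε₀ L₀, IsSignedPAdicLFunction f p ε₀ L₀ ∧ HasUnitContent L₀` for the newform `f` of `W`) gives `KobayashiLowerDivisibility W p ε`
  for BOTH signs (sign idleness on X7, `SignDefect.X7.exists_kobayashiLowerDivisibility_iff_forall`).

Argument order of every theorem: `hJ h12 h41 h5 h3 hD hC hS hmod hKim hPR hV hKan hEX3`, then the theorem's own binders. The period-unit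
facts `h5`/`h3` are dischargeable by `Theorems.realPeriodRat_eq_unit_mul_plusPeriod_holds` / `…_three_holds` (as in the line file v46).

References: [Kobayashi2003] Conjecture (p. 2), (3.6), Thm. 1.2, 4.1, 7.4; [BDKim2009] Cor. 2.13; [PollackRubin2004] Theorem (p. 448);
[Vatsal1999] (1.6), (1.13); [PollackWeston2011MT] §3.1, Thm. 4.1, Remark 4.2 (1); [GreenbergVatsal2000] §3 Rem. 3.4; [Pollack2003] Conj. 6.3,
Prop. 6.18; [PerrinRiou2003] Conj. 6.1.1.
-/

set_option autoImplicit false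
-- D-0017: single-problem summit, the namespace repeats the problem name by design.
set_option linter.dupNamespace false
noncomputable section

open scoped Classical MatrixGroups ModularForm BigOperators

open CongruenceSubgroup WeierstrassCurve Field Polynomial NumberField IsDedekindDomain
  Literature.NumberTheory.EllipticCurves Literature.NumberTheory.EllipticCurves.ModularForms
  Literature.NumberTheory.EllipticCurves.Rank1Residual
  Literature.NumberTheory.EllipticCurves.Kobayashi2003
  Literature.NumberTheory.EllipticCurves.GreenbergVatsal2000 ZpExtension
  Literature.NumberTheory.IwasawaTheory Rat.HeightOneSpectrum
  Summit.BirchSwinnertonDyer.Rank1Residual.Supersingular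
  Summit.BirchSwinnertonDyer.Rank1Residual.X1.MuLambda
  Summit.BirchSwinnertonDyer.Rank1Residual.X2.EulerFactorInvariants
  Summit.BirchSwinnertonDyer.BirchSwinnertonDyer.Theorems.SmallImageLambdaLowerThreeNsThetaTransport

namespace Summit.BirchSwinnertonDyer.BirchSwinnertonDyer.Theorems.SmallImageRttOneSided

/-- §1 ★ **The `p = 3` slice of crux L is floor-free.** On a small-image X7 pair `(W, 3)` (`a_3 = 0`, `¬ Surj W 3`, `W` non-CM):
`KobayashiLowerDivisibility W 3 ε` for BOTH signs `ε`, from the twelve prints, Kan₂ (`hKan`) and the ∃-partner-PSB binder (`hEX3`) — and NO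
μ-hypothesis: the proof is the transport `lamTransport_le_tiered3_of_existsPartnerPSB` followed by THEOREM B
(`forall_kobayashiLowerDivisibility_three_of_lamTransport_le`), i.e. the `p = 3` branch of
`smallImageLowerHalfBothSigns_of_oneSignFloor_of_existsPartnerPSB` verbatim. CONDITIONAL on its displayed hypotheses; closes nothing.
[cite: Kobayashi2003, Conjecture (p. 2), Thm. 7.4 (p. 13)] [cite: BDKim2009, Cor. 2.13] [cite: PollackRubin2004, Theorem (p. 448)]
[cite: PollackWeston2011MT, §3.1, Thm. 4.1 (1)] -/
theorem forall_kobayashiLowerDivisibility_three_of_existsPartnerPSB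
    (hJ : thm62_63_73_signedColemanKato_zetaJoint) (h12 : thm12_signedSelmerDual_finite_torsion)
    (h41 : thm41_signedCharIdeal_divisibility)
    (h5 : realPeriodRat_eq_unit_mul_plusPeriod) (h3 : realPeriodRat_eq_unit_mul_plusPeriod_three)
    (hD : Hida2000_thm326_exists_galoisRep) (hC : Carayol1986_artinConductorExponent)
    (hS : ∀ (V : WeierstrassCurve ℚ) (ℓ : ℕ) [Fact ℓ.Prime],
      V.swanConductorAt_rationalTate_eq_wildConductorExponent_of_ringChar_eq_two ℓ)
    (hmod : exists_isNewformOf)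
    (hKim : BDKim2009.cor213_signedLambda_add_sum_delta_eq_of_torsionIso)
    (hPR : PollackRubin2004.mainTheorem_signedCharIdeal_eq_of_cm) (hV : vatsal1999_plusSymbol_congruence)
    (hKan : ∀ (W : WeierstrassCurve ℚ) [W.IsElliptic] [W.IsGloballyMinimal] (p : ℕ) [Fact p.Prime],
      p ≠ 2 → ClassX7 W p → ¬ W.HasCM → W.frobeniusTrace p = 0 → ¬ Surj W p →
      ∀ (ε : ℤˣ), ∀ (M : ℕ) [NeZero M] (g : CuspForm (Gamma0 M) 2) (ι : coeffField g →+* PadicAlgCl p) (Ω : ℂ),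
        ¬ p ∣ M → (∀ ℓ : ℕ, ℓ.Prime → ℓ ≠ p → max 2 (padicValNat ℓ M) = max 2 (padicValNat ℓ (W.conductorNorm ℤ))) →
        IsNewform0 g → Literature.NumberTheory.Automorphic.IsCMForm (liftToGamma1 M 2 g) →
        cuspCoeff g p = 0 → IsPlusPeriod g Ω →
        (∀ ℓ : ℕ, ℓ.Prime → ¬ ℓ ∣ p * M * W.conductorNorm ℤ →
          ‖embCoeff g ι ℓ - (W.frobeniusTrace ℓ : PadicAlgCl p)‖ < 1) →
        ∀ [NeZero (W.conductorNorm ℤ)] (f : CuspForm (Gamma0 (W.conductorNorm ℤ)) 2), IsNewformOf W f →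
        ∀ (Lplus Lminus : IwasawaAlgebra p), IsPollackPair f p Lplus Lminus →
          HasUnitContent (kobayashiL ε Lplus Lminus) →
        ∀ (S₀ : Finset (HeightOneSpectrum (𝓞 ℚ))), (∀ v ∈ S₀, ((p : ℕ) : 𝓞 ℚ) ∉ v.asIdeal) →
          (∀ v : HeightOneSpectrum (𝓞 ℚ), ¬ W.HasGoodReductionAt v → v ∈ S₀) →
          (∀ v : HeightOneSpectrum (𝓞 ℚ), natGenerator v ∣ M → v ∈ S₀) →
        ∃ n₀ : ℕ, ∀ n ≥ n₀, (Even n ↔ ε = 1) →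
          layerLambda (((mazurTateElement f p n).map (algebraMap ℚ (PadicAlgCl p)) *
              ∏ v ∈ S₀, ((W.localPolynomialAt v).map (Int.castRingHom (PadicAlgCl p))).comp
                (C ((natGenerator v : PadicAlgCl p)⁻¹) *
                  (X + 1) ^ (PadicInt.toZModPow n (-(frobeniusExponent p (natGenerator v : ℤ_[p])))).val)) %ₘ
              ((X + 1) ^ p ^ n - 1)) =
          layerLambda (((mazurTateElementK g Ω p n).map ι *
              ∏ v ∈ S₀, (1 - C (embCoeff g ι (natGenerator v)) * X +
                  (if natGenerator v ∣ M then 0 else C (natGenerator v : PadicAlgCl p)) * X ^ 2).comp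
                (C ((natGenerator v : PadicAlgCl p)⁻¹) *
                  (X + 1) ^ (PadicInt.toZModPow n (-(frobeniusExponent p (natGenerator v : ℤ_[p])))).val)) %ₘ
              ((X + 1) ^ p ^ n - 1)))
    (hEX3 : ∀ (W : WeierstrassCurve ℚ) [W.IsElliptic] [W.IsGloballyMinimal] (p : ℕ) [Fact p.Prime],
      p ≠ 2 → ClassX7 W p → ¬ W.HasCM → W.frobeniusTrace p = 0 → ¬ Surj W p →
      ¬ (∃ (A : WeierstrassCurve ℚ) (_ : A.IsElliptic) (_ : A.IsGloballyMinimal),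
        A.HasCM ∧ GoodSS A p ∧ A.frobeniusTrace p = 0 ∧
          ∃ e : geomTorsion W (p : ℤ) ≃+ geomTorsion A (p : ℤ),
            ∀ (σ : absoluteGaloisGroup ℚ) (P : geomTorsion W (p : ℤ)), e (σ • P) = σ • e P) →
      ¬ (∃ (A : WeierstrassCurve ℚ) (_ : A.IsElliptic) (_ : A.IsGloballyMinimal) (t : ℚ),
        A.HasGoodReductionAtPrime p ∧ A.frobeniusTrace p = 0 ∧
          (∃ e : geomTorsion W (p : ℤ) ≃+ geomTorsion A (p : ℤ),
            ∀ (σ : absoluteGaloisGroup ℚ) (P : geomTorsion W (p : ℤ)), e (σ • P) = σ • e P) ∧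
          A.entireLFunction 1 / (A.realPeriodRat : ℂ) = ((t : ℚ) : ℂ) ∧ t ≠ 0 ∧ padicValRat p t = 0) →
      ∀ (ε : ℤˣ), ∃ (M : ℕ) (_ : NeZero M) (g : CuspForm (Gamma0 M) 2) (ι : coeffField g →+* PadicAlgCl p) (Ω : ℂ),
        ¬ p ∣ M ∧ IsNewform0 g ∧ Literature.NumberTheory.Automorphic.IsCMForm (liftToGamma1 M 2 g) ∧
          cuspCoeff g p = 0 ∧ IsCohomologicalPlusPeriod g ι Ω ∧
          (∀ ℓ : ℕ, ℓ.Prime → ¬ ℓ ∣ p * M * W.conductorNorm ℤ →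
            ‖embCoeff g ι ℓ - (W.frobeniusTrace ℓ : PadicAlgCl p)‖ < 1) ∧
          ∀ (κ : ZpExtension ℚ p) (γ : absoluteGaloisGroup ℚ),
            κ.IsCyclotomic → κ.IsTopGenerator γ → IsCyclotomicVariable p γ →
          ∀ (S₀ : Finset (HeightOneSpectrum (𝓞 ℚ))), (∀ v ∈ S₀, ((p : ℕ) : 𝓞 ℚ) ∉ v.asIdeal) →
            (∀ v : HeightOneSpectrum (𝓞 ℚ), ¬ W.HasGoodReductionAt v → v ∈ S₀) →
            (∀ v : HeightOneSpectrum (𝓞 ℚ), natGenerator v ∣ M → v ∈ S₀) →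
          ∀ (D : SignedSelmerDualData W κ γ ε) [Module.Finite (IwasawaAlgebra p) D.X],
            Module.IsTorsion (IwasawaAlgebra p) D.X → D.mu = 0 →
          ∀ L : IwasawaAlgebraO (Set.range ι), L ≠ 0 →
            (∀ n : ℕ, (Even n ↔ ε = 1) → IsCongrModOmegaO (Set.range ι) n ((mazurTateElementK g Ω p n).map ι)
              (((((-1) ^ (n / 2 + 1) * (if ε = 1 then cyclotomicOmegaMinus p n else cyclotomicOmegaPlus p n)).map
                  (Int.castRingHom (PadicAlgCl p)) : (PadicAlgCl p)[X]) : PowerSeries (PadicAlgCl p)) *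
                iwasawaOToPowerSeries (Set.range ι) L)) →
            ∃ d : ℕ, (∀ k : ℕ, ‖PowerSeries.coeff k (iwasawaOToPowerSeries (Set.range ι) L)‖ ≤
                ‖PowerSeries.coeff d (iwasawaOToPowerSeries (Set.range ι) L)‖) ∧
              (∀ k : ℕ, k < d → ‖PowerSeries.coeff k (iwasawaOToPowerSeries (Set.range ι) L)‖ <
                ‖PowerSeries.coeff d (iwasawaOToPowerSeries (Set.range ι) L)‖) ∧
              d + ∑ v ∈ S₀, p ^ (frobeniusExponent p (natGenerator v : ℤ_[p])).valuation *
                layerLambda ((1 - C (embCoeff g ι (natGenerator v)) * X +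
                  (if natGenerator v ∣ M then 0 else C (natGenerator v : PadicAlgCl p)) * X ^ 2).comp
                    (C ((natGenerator v : PadicAlgCl p)⁻¹) * (X + 1))) ≤
                lambdaInvariant p D.X + ∑ v ∈ S₀, delta W p v) :
    ∀ (W : WeierstrassCurve ℚ) [W.IsElliptic] [W.IsGloballyMinimal] (p : ℕ) [Fact p.Prime],
      p = 3 → ClassX7 W p → ¬ W.HasCM → W.frobeniusTrace p = 0 → ¬ Surj W p →
      ∀ ε : ℤˣ, KobayashiLowerDivisibility W p ε := by
  intro W _ _ p _ hp3 hX hCM hap hs ε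
  have hp2 : p ≠ 2 := by omega
  have hT := lamTransport_le_tiered3_of_existsPartnerPSB h12 hKim hPR hmod hD hC hS h5 h3 hV hKan hEX3 W p hp2 hX hCM hap hs
  exact forall_kobayashiLowerDivisibility_three_of_lamTransport_le W p hp3 hJ h12 h41 h5 h3 hX hap hs
    (fun ε' κ γ hκ hγ hγ' _ f hf ϖ hϖ Lplus Lminus hPP hfl D _ hXt hμ G m hG ↦
      hT ε' κ γ hκ hγ hγ' f hf ϖ hϖ Lplus Lminus hPP hfl D hXt hμ G m hG) ε

/-- §2 ★ **Per pair: a one-sign unit-content certificate AT `(W, p)` gives the full signed main conjecture for that sign.** For `p` odd,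
`W` on the small-image X7 class at `p` (`a_p = 0`, `¬ Surj W p`, non-CM) and a sign `ε₀` such that Kobayashi's `L_p^{ε₀}(E)` — read off ANY
Pollack pair of the newform of `W` as `kobayashiL ε₀ L⁺ L⁻` — has unit content (`hfl`): `KobayashiMainConjecture W p ε₀`, from the twelve
prints, Kan₂ and the ∃-partner-PSB binder. Proof = the `hMC` step of `smallImageLowerHalfBothSigns_of_oneSignFloor_of_existsPartnerPSB`
(`kobayashiMainConjecture_of_lamTransport_le` on the ∃-partner transport); NO `5 ≤ p` is needed. `hfl` is dischargeable per pair by a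
unit-orbit-sum certificate of one Mazur–Tate element (`…SmallImageOrbitSumMu`, p636207). CONDITIONAL; closes nothing.
[cite: Kobayashi2003, Conjecture (p. 2), (3.6), Thm. 7.4 (p. 13)] [cite: Pollack2003, Prop. 6.18] [cite: BDKim2009, Cor. 2.13]
[cite: PollackRubin2004, Theorem (p. 448)] -/
theorem kobayashiMainConjecture_of_oneSignFloorAt_of_existsPartnerPSB
    (hJ : thm62_63_73_signedColemanKato_zetaJoint) (h12 : thm12_signedSelmerDual_finite_torsion)
    (h41 : thm41_signedCharIdeal_divisibility)
    (h5 : realPeriodRat_eq_unit_mul_plusPeriod) (h3 : realPeriodRat_eq_unit_mul_plusPeriod_three)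
    (hD : Hida2000_thm326_exists_galoisRep) (hC : Carayol1986_artinConductorExponent)
    (hS : ∀ (V : WeierstrassCurve ℚ) (ℓ : ℕ) [Fact ℓ.Prime],
      V.swanConductorAt_rationalTate_eq_wildConductorExponent_of_ringChar_eq_two ℓ)
    (hmod : exists_isNewformOf)
    (hKim : BDKim2009.cor213_signedLambda_add_sum_delta_eq_of_torsionIso)
    (hPR : PollackRubin2004.mainTheorem_signedCharIdeal_eq_of_cm) (hV : vatsal1999_plusSymbol_congruence)
    (hKan : ∀ (W : WeierstrassCurve ℚ) [W.IsElliptic] [W.IsGloballyMinimal] (p : ℕ) [Fact p.Prime],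
      p ≠ 2 → ClassX7 W p → ¬ W.HasCM → W.frobeniusTrace p = 0 → ¬ Surj W p →
      ∀ (ε : ℤˣ), ∀ (M : ℕ) [NeZero M] (g : CuspForm (Gamma0 M) 2) (ι : coeffField g →+* PadicAlgCl p) (Ω : ℂ),
        ¬ p ∣ M → (∀ ℓ : ℕ, ℓ.Prime → ℓ ≠ p → max 2 (padicValNat ℓ M) = max 2 (padicValNat ℓ (W.conductorNorm ℤ))) →
        IsNewform0 g → Literature.NumberTheory.Automorphic.IsCMForm (liftToGamma1 M 2 g) →
        cuspCoeff g p = 0 → IsPlusPeriod g Ω →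
        (∀ ℓ : ℕ, ℓ.Prime → ¬ ℓ ∣ p * M * W.conductorNorm ℤ →
          ‖embCoeff g ι ℓ - (W.frobeniusTrace ℓ : PadicAlgCl p)‖ < 1) →
        ∀ [NeZero (W.conductorNorm ℤ)] (f : CuspForm (Gamma0 (W.conductorNorm ℤ)) 2), IsNewformOf W f →
        ∀ (Lplus Lminus : IwasawaAlgebra p), IsPollackPair f p Lplus Lminus →
          HasUnitContent (kobayashiL ε Lplus Lminus) →
        ∀ (S₀ : Finset (HeightOneSpectrum (𝓞 ℚ))), (∀ v ∈ S₀, ((p : ℕ) : 𝓞 ℚ) ∉ v.asIdeal) →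
          (∀ v : HeightOneSpectrum (𝓞 ℚ), ¬ W.HasGoodReductionAt v → v ∈ S₀) →
          (∀ v : HeightOneSpectrum (𝓞 ℚ), natGenerator v ∣ M → v ∈ S₀) →
        ∃ n₀ : ℕ, ∀ n ≥ n₀, (Even n ↔ ε = 1) →
          layerLambda (((mazurTateElement f p n).map (algebraMap ℚ (PadicAlgCl p)) *
              ∏ v ∈ S₀, ((W.localPolynomialAt v).map (Int.castRingHom (PadicAlgCl p))).comp
                (C ((natGenerator v : PadicAlgCl p)⁻¹) *
                  (X + 1) ^ (PadicInt.toZModPow n (-(frobeniusExponent p (natGenerator v : ℤ_[p])))).val)) %ₘ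
              ((X + 1) ^ p ^ n - 1)) =
          layerLambda (((mazurTateElementK g Ω p n).map ι *
              ∏ v ∈ S₀, (1 - C (embCoeff g ι (natGenerator v)) * X +
                  (if natGenerator v ∣ M then 0 else C (natGenerator v : PadicAlgCl p)) * X ^ 2).comp
                (C ((natGenerator v : PadicAlgCl p)⁻¹) *
                  (X + 1) ^ (PadicInt.toZModPow n (-(frobeniusExponent p (natGenerator v : ℤ_[p])))).val)) %ₘ
              ((X + 1) ^ p ^ n - 1)))
    (hEX3 : ∀ (W : WeierstrassCurve ℚ) [W.IsElliptic] [W.IsGloballyMinimal] (p : ℕ) [Fact p.Prime],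
      p ≠ 2 → ClassX7 W p → ¬ W.HasCM → W.frobeniusTrace p = 0 → ¬ Surj W p →
      ¬ (∃ (A : WeierstrassCurve ℚ) (_ : A.IsElliptic) (_ : A.IsGloballyMinimal),
        A.HasCM ∧ GoodSS A p ∧ A.frobeniusTrace p = 0 ∧
          ∃ e : geomTorsion W (p : ℤ) ≃+ geomTorsion A (p : ℤ),
            ∀ (σ : absoluteGaloisGroup ℚ) (P : geomTorsion W (p : ℤ)), e (σ • P) = σ • e P) →
      ¬ (∃ (A : WeierstrassCurve ℚ) (_ : A.IsElliptic) (_ : A.IsGloballyMinimal) (t : ℚ),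
        A.HasGoodReductionAtPrime p ∧ A.frobeniusTrace p = 0 ∧
          (∃ e : geomTorsion W (p : ℤ) ≃+ geomTorsion A (p : ℤ),
            ∀ (σ : absoluteGaloisGroup ℚ) (P : geomTorsion W (p : ℤ)), e (σ • P) = σ • e P) ∧
          A.entireLFunction 1 / (A.realPeriodRat : ℂ) = ((t : ℚ) : ℂ) ∧ t ≠ 0 ∧ padicValRat p t = 0) →
      ∀ (ε : ℤˣ), ∃ (M : ℕ) (_ : NeZero M) (g : CuspForm (Gamma0 M) 2) (ι : coeffField g →+* PadicAlgCl p) (Ω : ℂ),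
        ¬ p ∣ M ∧ IsNewform0 g ∧ Literature.NumberTheory.Automorphic.IsCMForm (liftToGamma1 M 2 g) ∧
          cuspCoeff g p = 0 ∧ IsCohomologicalPlusPeriod g ι Ω ∧
          (∀ ℓ : ℕ, ℓ.Prime → ¬ ℓ ∣ p * M * W.conductorNorm ℤ →
            ‖embCoeff g ι ℓ - (W.frobeniusTrace ℓ : PadicAlgCl p)‖ < 1) ∧
          ∀ (κ : ZpExtension ℚ p) (γ : absoluteGaloisGroup ℚ),
            κ.IsCyclotomic → κ.IsTopGenerator γ → IsCyclotomicVariable p γ →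
          ∀ (S₀ : Finset (HeightOneSpectrum (𝓞 ℚ))), (∀ v ∈ S₀, ((p : ℕ) : 𝓞 ℚ) ∉ v.asIdeal) →
            (∀ v : HeightOneSpectrum (𝓞 ℚ), ¬ W.HasGoodReductionAt v → v ∈ S₀) →
            (∀ v : HeightOneSpectrum (𝓞 ℚ), natGenerator v ∣ M → v ∈ S₀) →
          ∀ (D : SignedSelmerDualData W κ γ ε) [Module.Finite (IwasawaAlgebra p) D.X],
            Module.IsTorsion (IwasawaAlgebra p) D.X → D.mu = 0 →
          ∀ L : IwasawaAlgebraO (Set.range ι), L ≠ 0 →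
            (∀ n : ℕ, (Even n ↔ ε = 1) → IsCongrModOmegaO (Set.range ι) n ((mazurTateElementK g Ω p n).map ι)
              (((((-1) ^ (n / 2 + 1) * (if ε = 1 then cyclotomicOmegaMinus p n else cyclotomicOmegaPlus p n)).map
                  (Int.castRingHom (PadicAlgCl p)) : (PadicAlgCl p)[X]) : PowerSeries (PadicAlgCl p)) *
                iwasawaOToPowerSeries (Set.range ι) L)) →
            ∃ d : ℕ, (∀ k : ℕ, ‖PowerSeries.coeff k (iwasawaOToPowerSeries (Set.range ι) L)‖ ≤
                ‖PowerSeries.coeff d (iwasawaOToPowerSeries (Set.range ι) L)‖) ∧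
              (∀ k : ℕ, k < d → ‖PowerSeries.coeff k (iwasawaOToPowerSeries (Set.range ι) L)‖ <
                ‖PowerSeries.coeff d (iwasawaOToPowerSeries (Set.range ι) L)‖) ∧
              d + ∑ v ∈ S₀, p ^ (frobeniusExponent p (natGenerator v : ℤ_[p])).valuation *
                layerLambda ((1 - C (embCoeff g ι (natGenerator v)) * X +
                  (if natGenerator v ∣ M then 0 else C (natGenerator v : PadicAlgCl p)) * X ^ 2).comp
                    (C ((natGenerator v : PadicAlgCl p)⁻¹) * (X + 1))) ≤
                lambdaInvariant p D.X + ∑ v ∈ S₀, delta W p v)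
    (W : WeierstrassCurve ℚ) [W.IsElliptic] [W.IsGloballyMinimal] (p : ℕ) [Fact p.Prime]
    (hp2 : p ≠ 2) (hX : ClassX7 W p) (hCM : ¬ W.HasCM) (hap : W.frobeniusTrace p = 0) (hs : ¬ Surj W p) (ε₀ : ℤˣ)
    (hfl : ∀ [NeZero (W.conductorNorm ℤ)] (f : CuspForm (Gamma0 (W.conductorNorm ℤ)) 2), IsNewformOf W f →
      ∀ Lplus Lminus : IwasawaAlgebra p, IsPollackPair f p Lplus Lminus → HasUnitContent (kobayashiL ε₀ Lplus Lminus)) :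
    KobayashiMainConjecture W p ε₀ := by
  have hT := lamTransport_le_tiered3_of_existsPartnerPSB h12 hKim hPR hmod hD hC hS h5 h3 hV hKan hEX3 W p hp2 hX hCM hap hs
  exact kobayashiMainConjecture_of_lamTransport_le W p hp2 (thm62_63_73_signedColemanKato_zeta_of_joint hJ) h12 h41 h5 h3
    hX.1.1 hap hs ε₀ (fun f hf Lplus Lminus hPP ↦ hfl f hf Lplus Lminus hPP)
    (fun κ γ hκ hγ hγ' _ f hf ϖ hϖ Lplus Lminus hPP D _ hXt hμ G m hG ↦
      hT ε₀ κ γ hκ hγ hγ' f hf ϖ hϖ Lplus Lminus hPP (hfl f hf Lplus Lminus hPP) D hXt hμ G m hG)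

/-- §3 ★ **Per pair: the analytic one-sign floor AT `(W, p)` gives Kobayashi's lower divisibility for BOTH signs.** For `p` odd and `W` on
the small-image X7 class at `p`: if for the newform `f` of `W` SOME signed `p`-adic `L`-function `L_p^{ε₀}(E)` has unit content
(`hfloorAt` — the line's stub `stub_muOneSign_ns_ge5` SPECIALISED to this one pair, no `5 ≤ p`), then `KobayashiLowerDivisibility W p ε`
for every sign `ε`: pick the sign uniformly in `f` (`LargeImageMuFloor.exists_sign_forall_isNewformOf`), identify `L₀` with `kobayashiL ε₀`
of any Pollack pair (`IsSignedPAdicLFunction.unique`), get the main conjecture for `ε₀` by §2, and pass to both signs by sign idleness on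
X7 (`SignDefect.X7.exists_kobayashiLowerDivisibility_iff_forall`) — the `5 ≤ p` branch of
`smallImageLowerHalfBothSigns_of_oneSignFloor_of_existsPartnerPSB` verbatim with the class-wide floor replaced by the floor at the pair.
CONDITIONAL; closes nothing. [cite: Kobayashi2003, Conjecture (p. 2), Thm. 7.4 (p. 13)] [cite: Pollack2003, Conj. 6.3, Prop. 6.18]
[cite: PollackWeston2011MT, Remark 4.2 (1)] -/
theorem forall_kobayashiLowerDivisibility_of_oneSignFloorAt_of_existsPartnerPSB
    (hJ : thm62_63_73_signedColemanKato_zetaJoint) (h12 : thm12_signedSelmerDual_finite_torsion)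
    (h41 : thm41_signedCharIdeal_divisibility)
    (h5 : realPeriodRat_eq_unit_mul_plusPeriod) (h3 : realPeriodRat_eq_unit_mul_plusPeriod_three)
    (hD : Hida2000_thm326_exists_galoisRep) (hC : Carayol1986_artinConductorExponent)
    (hS : ∀ (V : WeierstrassCurve ℚ) (ℓ : ℕ) [Fact ℓ.Prime],
      V.swanConductorAt_rationalTate_eq_wildConductorExponent_of_ringChar_eq_two ℓ)
    (hmod : exists_isNewformOf)
    (hKim : BDKim2009.cor213_signedLambda_add_sum_delta_eq_of_torsionIso)
    (hPR : PollackRubin2004.mainTheorem_signedCharIdeal_eq_of_cm) (hV : vatsal1999_plusSymbol_congruence)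
    (hKan : ∀ (W : WeierstrassCurve ℚ) [W.IsElliptic] [W.IsGloballyMinimal] (p : ℕ) [Fact p.Prime],
      p ≠ 2 → ClassX7 W p → ¬ W.HasCM → W.frobeniusTrace p = 0 → ¬ Surj W p →
      ∀ (ε : ℤˣ), ∀ (M : ℕ) [NeZero M] (g : CuspForm (Gamma0 M) 2) (ι : coeffField g →+* PadicAlgCl p) (Ω : ℂ),
        ¬ p ∣ M → (∀ ℓ : ℕ, ℓ.Prime → ℓ ≠ p → max 2 (padicValNat ℓ M) = max 2 (padicValNat ℓ (W.conductorNorm ℤ))) →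
        IsNewform0 g → Literature.NumberTheory.Automorphic.IsCMForm (liftToGamma1 M 2 g) →
        cuspCoeff g p = 0 → IsPlusPeriod g Ω →
        (∀ ℓ : ℕ, ℓ.Prime → ¬ ℓ ∣ p * M * W.conductorNorm ℤ →
          ‖embCoeff g ι ℓ - (W.frobeniusTrace ℓ : PadicAlgCl p)‖ < 1) →
        ∀ [NeZero (W.conductorNorm ℤ)] (f : CuspForm (Gamma0 (W.conductorNorm ℤ)) 2), IsNewformOf W f →
        ∀ (Lplus Lminus : IwasawaAlgebra p), IsPollackPair f p Lplus Lminus →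
          HasUnitContent (kobayashiL ε Lplus Lminus) →
        ∀ (S₀ : Finset (HeightOneSpectrum (𝓞 ℚ))), (∀ v ∈ S₀, ((p : ℕ) : 𝓞 ℚ) ∉ v.asIdeal) →
          (∀ v : HeightOneSpectrum (𝓞 ℚ), ¬ W.HasGoodReductionAt v → v ∈ S₀) →
          (∀ v : HeightOneSpectrum (𝓞 ℚ), natGenerator v ∣ M → v ∈ S₀) →
        ∃ n₀ : ℕ, ∀ n ≥ n₀, (Even n ↔ ε = 1) →
          layerLambda (((mazurTateElement f p n).map (algebraMap ℚ (PadicAlgCl p)) *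
              ∏ v ∈ S₀, ((W.localPolynomialAt v).map (Int.castRingHom (PadicAlgCl p))).comp
                (C ((natGenerator v : PadicAlgCl p)⁻¹) *
                  (X + 1) ^ (PadicInt.toZModPow n (-(frobeniusExponent p (natGenerator v : ℤ_[p])))).val)) %ₘ
              ((X + 1) ^ p ^ n - 1)) =
          layerLambda (((mazurTateElementK g Ω p n).map ι *
              ∏ v ∈ S₀, (1 - C (embCoeff g ι (natGenerator v)) * X +
                  (if natGenerator v ∣ M then 0 else C (natGenerator v : PadicAlgCl p)) * X ^ 2).comp
                (C ((natGenerator v : PadicAlgCl p)⁻¹) *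
                  (X + 1) ^ (PadicInt.toZModPow n (-(frobeniusExponent p (natGenerator v : ℤ_[p])))).val)) %ₘ
              ((X + 1) ^ p ^ n - 1)))
    (hEX3 : ∀ (W : WeierstrassCurve ℚ) [W.IsElliptic] [W.IsGloballyMinimal] (p : ℕ) [Fact p.Prime],
      p ≠ 2 → ClassX7 W p → ¬ W.HasCM → W.frobeniusTrace p = 0 → ¬ Surj W p →
      ¬ (∃ (A : WeierstrassCurve ℚ) (_ : A.IsElliptic) (_ : A.IsGloballyMinimal),
        A.HasCM ∧ GoodSS A p ∧ A.frobeniusTrace p = 0 ∧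
          ∃ e : geomTorsion W (p : ℤ) ≃+ geomTorsion A (p : ℤ),
            ∀ (σ : absoluteGaloisGroup ℚ) (P : geomTorsion W (p : ℤ)), e (σ • P) = σ • e P) →
      ¬ (∃ (A : WeierstrassCurve ℚ) (_ : A.IsElliptic) (_ : A.IsGloballyMinimal) (t : ℚ),
        A.HasGoodReductionAtPrime p ∧ A.frobeniusTrace p = 0 ∧
          (∃ e : geomTorsion W (p : ℤ) ≃+ geomTorsion A (p : ℤ),
            ∀ (σ : absoluteGaloisGroup ℚ) (P : geomTorsion W (p : ℤ)), e (σ • P) = σ • e P) ∧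
          A.entireLFunction 1 / (A.realPeriodRat : ℂ) = ((t : ℚ) : ℂ) ∧ t ≠ 0 ∧ padicValRat p t = 0) →
      ∀ (ε : ℤˣ), ∃ (M : ℕ) (_ : NeZero M) (g : CuspForm (Gamma0 M) 2) (ι : coeffField g →+* PadicAlgCl p) (Ω : ℂ),
        ¬ p ∣ M ∧ IsNewform0 g ∧ Literature.NumberTheory.Automorphic.IsCMForm (liftToGamma1 M 2 g) ∧
          cuspCoeff g p = 0 ∧ IsCohomologicalPlusPeriod g ι Ω ∧
          (∀ ℓ : ℕ, ℓ.Prime → ¬ ℓ ∣ p * M * W.conductorNorm ℤ →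
            ‖embCoeff g ι ℓ - (W.frobeniusTrace ℓ : PadicAlgCl p)‖ < 1) ∧
          ∀ (κ : ZpExtension ℚ p) (γ : absoluteGaloisGroup ℚ),
            κ.IsCyclotomic → κ.IsTopGenerator γ → IsCyclotomicVariable p γ →
          ∀ (S₀ : Finset (HeightOneSpectrum (𝓞 ℚ))), (∀ v ∈ S₀, ((p : ℕ) : 𝓞 ℚ) ∉ v.asIdeal) →
            (∀ v : HeightOneSpectrum (𝓞 ℚ), ¬ W.HasGoodReductionAt v → v ∈ S₀) →
            (∀ v : HeightOneSpectrum (𝓞 ℚ), natGenerator v ∣ M → v ∈ S₀) →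
          ∀ (D : SignedSelmerDualData W κ γ ε) [Module.Finite (IwasawaAlgebra p) D.X],
            Module.IsTorsion (IwasawaAlgebra p) D.X → D.mu = 0 →
          ∀ L : IwasawaAlgebraO (Set.range ι), L ≠ 0 →
            (∀ n : ℕ, (Even n ↔ ε = 1) → IsCongrModOmegaO (Set.range ι) n ((mazurTateElementK g Ω p n).map ι)
              (((((-1) ^ (n / 2 + 1) * (if ε = 1 then cyclotomicOmegaMinus p n else cyclotomicOmegaPlus p n)).map
                  (Int.castRingHom (PadicAlgCl p)) : (PadicAlgCl p)[X]) : PowerSeries (PadicAlgCl p)) *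
                iwasawaOToPowerSeries (Set.range ι) L)) →
            ∃ d : ℕ, (∀ k : ℕ, ‖PowerSeries.coeff k (iwasawaOToPowerSeries (Set.range ι) L)‖ ≤
                ‖PowerSeries.coeff d (iwasawaOToPowerSeries (Set.range ι) L)‖) ∧
              (∀ k : ℕ, k < d → ‖PowerSeries.coeff k (iwasawaOToPowerSeries (Set.range ι) L)‖ <
                ‖PowerSeries.coeff d (iwasawaOToPowerSeries (Set.range ι) L)‖) ∧
              d + ∑ v ∈ S₀, p ^ (frobeniusExponent p (natGenerator v : ℤ_[p])).valuation *
                layerLambda ((1 - C (embCoeff g ι (natGenerator v)) * X +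
                  (if natGenerator v ∣ M then 0 else C (natGenerator v : PadicAlgCl p)) * X ^ 2).comp
                    (C ((natGenerator v : PadicAlgCl p)⁻¹) * (X + 1))) ≤
                lambdaInvariant p D.X + ∑ v ∈ S₀, delta W p v)
    (W : WeierstrassCurve ℚ) [W.IsElliptic] [W.IsGloballyMinimal] (p : ℕ) [Fact p.Prime]
    (hp2 : p ≠ 2) (hX : ClassX7 W p) (hCM : ¬ W.HasCM) (hap : W.frobeniusTrace p = 0) (hs : ¬ Surj W p)
    (hfloorAt : ∀ [NeZero (W.conductorNorm ℤ)] (f : CuspForm (Gamma0 (W.conductorNorm ℤ)) 2),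
      IsNewformOf W f → ∃ (ε₀ : ℤˣ) (L₀ : IwasawaAlgebra p), IsSignedPAdicLFunction f p ε₀ L₀ ∧ HasUnitContent L₀) :
    ∀ ε : ℤˣ, KobayashiLowerDivisibility W p ε := by
  intro ε
  obtain ⟨ε₀, hε₀⟩ := LargeImageMuFloor.exists_sign_forall_isNewformOf (W := W)
    (fun ε f ↦ ∃ L₀ : IwasawaAlgebra p, IsSignedPAdicLFunction f p ε L₀ ∧ HasUnitContent L₀)
    (fun f hf ↦ hfloorAt f hf)
  have hfl : ∀ [NeZero (W.conductorNorm ℤ)] (f : CuspForm (Gamma0 (W.conductorNorm ℤ)) 2), IsNewformOf W f →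
      ∀ Lplus Lminus : IwasawaAlgebra p, IsPollackPair f p Lplus Lminus →
        HasUnitContent (kobayashiL ε₀ Lplus Lminus) := by
    intro _ f hf Lplus Lminus hPP
    obtain ⟨L₀, hL₀, hu⟩ := hε₀ f hf
    rwa [IsSignedPAdicLFunction.unique hL₀ (hPP.isSignedPAdicLFunction_kobayashiL ε₀)] at hu
  have hMC : KobayashiMainConjecture W p ε₀ :=
    kobayashiMainConjecture_of_oneSignFloorAt_of_existsPartnerPSB hJ h12 h41 h5 h3 hD hC hS hmod hKim hPR hV hKan hEX3
      W p hp2 hX hCM hap hs ε₀ (fun f hf Lplus Lminus hPP ↦ hfl f hf Lplus Lminus hPP)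
  exact (SignDefect.X7.exists_kobayashiLowerDivisibility_iff_forall W p h12 h5 h3 hJ hp2 hX hap).mp
    ⟨ε₀, kobayashiLowerDivisibility_of_mainConjecture hMC⟩ ε

end Summit.BirchSwinnertonDyer.BirchSwinnertonDyer.Theorems.SmallImageRttOneSided

end
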